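import Summits.CriticalPhenomena.PercolationContinuityZ3.Theorems.SahiMasterFamilyComparableStep
import Literature.Combinatorics.Sahi2008.FKGCumulation

/-!
# Kahn's Conjecture 5 off the residual class: principal slot ∨ nested pair ∨ independent pair ⇒ `E₃ ≥ 0`

Companion of `SahiMasterFamily.lean` (crux `NoHeavyLowerTail`, stmt-CriticalPhenomena-4575; unit `prim-masterthm-p4`).
The "induction on `k`" census of the unit (run/shared/lean/prim/prim-masterthm/MASTER-ROUTES.md §P4.3) shows that the
proved all-`k` reduction identities — Blinovsky's tilt at a PRINCIPAL slot [Blinovsky2013; tree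
`Literature.Combinatorics.Sahi2008.sahiE_nonneg_of_isLatticeCumulation_offTwo`], the comparable-slot step
(`sahiE_three_ind_nonneg_of_subset`, tree `SahiMasterFamilyComparableStep`) and the zero-flag / independent-pair step
(`sahiE_three_ind_nonneg_of_indepPair`, tree `SahiMasterFamilyHeredity`) — reduce `C₃` on product measures to Harris
for EVERY triple of increasing events except the RESIDUAL CLASS
`𝓡₃ = {antichains of three pairwise-dependent increasing events, none of them principal}`
(on `{0,1}³`: 3 of the 1 540 triples; on `{0,1}⁴`: 93 986 of 804 440).  This file assembles the three strata into one
theorem, `sahiE_three_ind_nonneg_of_not_residual`: for three increasing events `U_0, U_1, U_2` of a finite product space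
and every `p ∈ [0,1]^ι`, if SOME `U_i` is a principal up-set `{ω | S ⊆ ω}` (this includes `U_i = univ`), or SOME
`U_j ⊆ U_i` (`i ≠ j`; this includes `U_j = ∅`), or SOME two of them are determined by disjoint coordinate sets, then
`E₃(μ_p; 1_{U_0}, 1_{U_1}, 1_{U_2}) ≥ 0`.  So any proof (or counterexample) of Kahn's Conjecture 5 may assume the triple
lies in `𝓡₃`.  Nothing here asserts `C₃`. [this work]
-/

noncomputable section

open scoped Classical

namespace Summit.CriticalPhenomena.PercolationContinuityZ3.Theorems

open Finset Function
open Literature.Combinatorics.Sahi2008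
open Literature.Probability.Percolation (DeterminedBy)
open Literature.Probability.Percolation.DecisionTree (ind ind_of_mem ind_of_not_mem ind_nonneg)

variable {ι : Type} [Fintype ι]

omit [Fintype ι] in
/-- The indicator of the principal up-set `{ω | S ⊆ ω}` of the lattice `Set ι` is a lattice cumulation (the cone `𝒞`
of [Sahi2008]: here a single generator). [this work] -/
theorem isLatticeCumulation_ind_principal [Fintype (Set ι)] (S : Set ι) :
    IsLatticeCumulation (ind {ω : Set ι | S ⊆ ω}) := by
  refine ⟨fun c => if c = S then 1 else 0, fun c => ?_, funext fun ω => ?_⟩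
  · show (0 : ℝ) ≤ if c = S then 1 else 0
    split_ifs <;> norm_num
  · have hsum : (∑ c : Set ι, if c ⊆ ω then (fun c => if c = S then (1 : ℝ) else 0) c else 0) =
        if S ⊆ ω then 1 else 0 := by
      rw [Finset.sum_eq_single S]
      · simp
      · intro c _ hc
        simp [hc]
      · intro h; exact absurd (Finset.mem_univ S) h
    rw [hsum]
    by_cases h : S ⊆ ω
    · rw [ind_of_mem (show ω ∈ {ω : Set ι | S ⊆ ω} from h), if_pos h]
    · rw [ind_of_not_mem (show ω ∉ {ω : Set ι | S ⊆ ω} from h), if_neg h]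

/-- **Principal slot** (Sahi's Theorem 2 / Blinovsky, `n = 3`, product weight): if one of three increasing events is a
principal up-set `{ω | S ⊆ ω}`, then `E₃(μ_p; 1_U) ≥ 0`. [cite: Sahi2008, Thm. 2 (p. 211); Blinovsky2013, eq. (ee3)] -/
theorem sahiE_three_ind_nonneg_of_principal (p : ι → unitInterval) (U : Fin 3 → Set (Set ι))
    (hU : ∀ j, IsUpperSet (U j)) (i : Fin 3) (S : Set ι) (hS : U i = {ω | S ⊆ ω}) :
    0 ≤ sahiE (bernoulliWeight p) 3 (fun j => ind (U j)) := by
  refine sahiE_nonneg_of_isLatticeCumulation_offTwo (isFKGMeasure_bernoulliWeight p) _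
    (ind_family_nonneg_monotone hU).1 (ind_family_nonneg_monotone hU).2 (Finset.univ.erase i) ?_ fun j hj => ?_
  · rw [Finset.card_erase_of_mem (Finset.mem_univ i), Finset.card_univ, Fintype.card_fin]
  · have hji : j = i := by
      by_contra h; exact hj (Finset.mem_erase.2 ⟨h, Finset.mem_univ j⟩)
    rw [hji, hS]
    exact isLatticeCumulation_ind_principal S

/-- **`C₃` off the residual class.**  For three increasing events of a finite product space and every `p ∈ [0,1]^ι`: if
some event is principal, or some event contains another, or some two events are determined by disjoint coordinate sets,
then `E₃(μ_p; 1_{U_0}, 1_{U_1}, 1_{U_2}) ≥ 0`.  (The complement of these three strata is the residual class `𝓡₃` of the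
unit's `k`-induction census.) [this work] -/
theorem sahiE_three_ind_nonneg_of_not_residual (p : ι → unitInterval) (U : Fin 3 → Set (Set ι))
    (hU : ∀ j, IsUpperSet (U j))
    (h : (∃ (i : Fin 3) (S : Set ι), U i = {ω | S ⊆ ω}) ∨
      (∃ i j : Fin 3, j ≠ i ∧ U j ⊆ U i) ∨
      (∃ m : Fin 3, SuppZeroFlag 2 (fun j => U (m.succAbove j)))) :
    0 ≤ sahiE (bernoulliWeight p) 3 (fun j => ind (U j)) := by
  rcases h with ⟨i, S, hS⟩ | ⟨i, j, hij, hsub⟩ | ⟨m, hZ⟩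
  · exact sahiE_three_ind_nonneg_of_principal p U hU i S hS
  · exact sahiE_three_ind_nonneg_of_subset p U hU hij hsub
  · exact sahiE_three_ind_nonneg_of_indepPair p U hU m hZ

/-- The same with the trivial members spelled out: `E₃ ≥ 0` as soon as some event is `∅`, `univ`, principal, contained
in another, or independent of another (disjoint determining sets). [this work] -/
theorem sahiE_three_ind_nonneg_of_trivial_or (p : ι → unitInterval) (U : Fin 3 → Set (Set ι))
    (hU : ∀ j, IsUpperSet (U j))
    (h : (∃ i, U i = ∅) ∨ (∃ i, U i = Set.univ) ∨ (∃ (i : Fin 3) (S : Set ι), U i = {ω | S ⊆ ω}) ∨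
      (∃ i j : Fin 3, j ≠ i ∧ U j ⊆ U i) ∨ (∃ m : Fin 3, SuppZeroFlag 2 (fun j => U (m.succAbove j)))) :
    0 ≤ sahiE (bernoulliWeight p) 3 (fun j => ind (U j)) := by
  rcases h with ⟨i, hi⟩ | ⟨i, hi⟩ | h
  · -- `∅` is contained in any other member
    obtain ⟨j, hj⟩ : ∃ j : Fin 3, j ≠ i := exists_ne i
    exact sahiE_three_ind_nonneg_of_not_residual p U hU (Or.inr (Or.inl ⟨j, i, hj.symm, by rw [hi]; exact Set.empty_subset _⟩))
  · -- `univ` is the principal up-set generated by `∅`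
    exact sahiE_three_ind_nonneg_of_not_residual p U hU (Or.inl ⟨i, ∅, by rw [hi]; ext ω; simp⟩)
  · exact sahiE_three_ind_nonneg_of_not_residual p U hU h

end Summit.CriticalPhenomena.PercolationContinuityZ3.Theorems
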